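import Literature.AnabelianGeometry.AbsoluteAnabelian.AbsCuspCohomology
import HarnessLib

/-!
# [AbsCusp] Prop. 2.1 (ii), exactness clause (`Prop_2_1_ii_ker`): the half that holds for EVERY
# presentation, and the reduction of the FACT-LIST rows F-0042 / F-0043 to the converse half

S. Mochizuki, *Absolute anabelian cuspidalizations of proper hyperbolic curves*, J. Math. Kyoto Univ.
**47** (2007), Prop. 2.1 (ii) p. 36 of the held copy (`paper:doi-10-1215-kjm-1250281022`): "restricting
cohomology classes of `Π_{U_S}` to the various `I_x[U_S]`, for `x ∈ S`, yields a natural exact sequence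
`1 → (k^×)^∧ → H¹(Π_{U_S}, M_X) → ⊕_{x∈S} Ẑ†`" [cite: MochizukiAbsCusp2007, Prop 2.1 (ii) p.36].
Seat abc-iut-L4-t16 typed the clause (`AbsCuspCohomology.lean`, p407057) VIA INFLATION–RESTRICTION as
the SCHEMA `AbsCusp.Prop_2_1_ii_ker r q I`: for every class `c ∈ H¹(Π_{U_S}, M_X)`,
"`c|_{I_x} = 0` for all `x ∈ S`  ↔  `c|_{Δ_{U_S}} = 0`", over an ARBITRARY presentation
`r : Π_{U_S} → Π_{U_x}`, `q : Π_{U_x} → Π_X` and an ARBITRARY family `I : S → Subgroup Π_{U_S}`; and the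
(M)-form `AbsCusp.Prop_2_1_ii_model M` over the `CurveModel` interface.

PROOF-ONLY companion (cell abc-iut, seat abc-iut-f-054, F fact-proving wave, FROZEN FACT-LIST rows
**F-0042** `Prop_2_1_ii_ker`, **F-0043** `Prop_2_1_ii_model`; the declaring file is imported, never
edited; no definition, no statement re-typed).  What is PROVED here, for ALL data:

* `geomCyclotomeH1Res_eq_zero_of_le` — restriction is transitive along `D' ≤ D ≤ Π_{U_S}`
  (Mathlib `ContinuousCohomology.map_comp`), so a class vanishing on `D` vanishes on `D'`;
* `prop_2_1_ii_ker_mpr` — the direction "(⇐)" of the schema: a class vanishing on `Δ_{U_S}` vanishes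
  on every `I_x ≤ Δ_{U_S}` (in print: the composite `(k^×)^∧ → H¹(Π_{U_S}, M_X) → ⊕ Ẑ†` is zero, the
  inertia groups being contained in `Δ_{U_S}`);  `prop_2_1_ii_model_mpr` — the same for every
  `CurveModel` (cuspidal inertia groups lie in `Δ`, `CuspidalData.Icusp_le_geom`);
* `prop_2_1_ii_ker_iff_forall_imp` — hence, whenever `I_x ≤ Δ_{U_S}` for all `x`, the row is
  EQUIVALENT to its converse half "(⇒)": `(∀ x, c|_{I_x} = 0) → c|_{Δ_{U_S}} = 0` (exactness AT
  `H¹(Π_{U_S}, M_X)`: a class unramified at all cusps comes from `G_k` — in print this rests on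
  `H¹(Δ_X, M_X)^{G_k} = 0`, a weight argument over an MLF, i.e. on arithmetic input the abstract
  presentation does not carry); `prop_2_1_ii_model_iff_forall_imp` — the same reduction for the
  (M)-form.

The converse half is NOT provable for arbitrary data: its universal closure is refuted in the companion
countermodel file (`AbsCuspCohomologyKerCountermodel.lean`, this seat).  HONEST FRAMING: a refereed,
undisputed result; the statements here concern OUR typed schema; no side taken on [IUTchIII] Cor. 3.12;
typed ≠ proved.
-/

noncomputable section

open CategoryTheory
open scoped Pointwise IsMulCommutative

namespace Literature.AnabelianGeometry.AbsoluteAnabelian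

namespace AbsCusp

open AbsTopIII

universe u

variable {E' E F : FundamentalExtension.{u}} (r : E' ⟶ E) (q : E ⟶ F)

/-! ### Restriction is transitive along inclusions of subgroups -/

/-- Restriction `H¹(Π_{U_S}, M_X) → H¹(D', M_X)` factors through `H¹(D, M_X)` for `D' ≤ D`: it is the
restriction to `D` followed by the restriction along the inclusion `D' ↪ D` (functoriality of Mathlib's
`ContinuousCohomology.map`). [cite: MochizukiAbsCusp2007, Prop 2.1 (ii) p.36] -/
theorem geomCyclotomeH1Res_eq_comp {D D' : Subgroup E'.arith} (h : D' ≤ D) :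
    geomCyclotomeH1Res r q D' =
      geomCyclotomeH1Res r q D ≫
        ContinuousCohomology.map.{0, u, u}
          (⟨Subgroup.inclusion h, continuous_inclusion (SetLike.coe_subset_coe.mpr h)⟩ : D' →ₜ* D)
          (𝟙 (TopRep.res
            ((⟨Subgroup.inclusion h, continuous_inclusion (SetLike.coe_subset_coe.mpr h)⟩ : D' →ₜ* D) : D' →* D)
            (TopRep.res (subgroupInclusion D : D →* E'.arith) (geomCyclotomeTopRep r q)))) 1 := by
  rw [geomCyclotomeH1Res, geomCyclotomeH1Res, ← ContinuousCohomology.map_comp]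
  simp only [Category.comp_id]
  rfl

/-- **Transitivity of vanishing under restriction**: if a class of `H¹(Π_{U_S}, M_X)` restricts to zero
on a subgroup `D`, it restricts to zero on every `D' ≤ D`. [cite: MochizukiAbsCusp2007, Prop 2.1 (ii) p.36] -/
theorem geomCyclotomeH1Res_eq_zero_of_le {D D' : Subgroup E'.arith} (h : D' ≤ D)
    (c : geomCyclotomeH1 r q) (hc : geomCyclotomeH1Res r q D c = 0) :
    geomCyclotomeH1Res r q D' c = 0 := by
  have hfac := congrArg (fun φ => (ConcreteCategory.hom φ) c) (geomCyclotomeH1Res_eq_comp r q h)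
  refine hfac.trans ?_
  have hc' : (geomCyclotomeH1Res r q D).hom c = 0 := hc
  change (ContinuousCohomology.map _ _ 1).hom ((geomCyclotomeH1Res r q D).hom c) = 0
  rw [hc', map_zero]

/-! ### Prop. 2.1 (ii): the half valid for every presentation -/

/-- **[AbsCusp] Prop. 2.1 (ii), direction "(⇐)", PROVED for every presentation**: if the inertia groups
`I_x` lie in `Δ_{U_S}`, a class of `H¹(Π_{U_S}, M_X)` vanishing on `Δ_{U_S}` vanishes on every `I_x`
("`1 → (k^×)^∧ → H¹(Π_{U_S}, M_X) → ⊕_{x∈S} Ẑ†`" is a complex). [cite: MochizukiAbsCusp2007, Prop 2.1 (ii) p.36] -/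
theorem prop_2_1_ii_ker_mpr {S : Type u} (I : S → Subgroup E'.arith) (hI : ∀ x, I x ≤ E'.geom)
    (c : geomCyclotomeH1 r q) (hc : geomCyclotomeH1Res r q E'.geom c = 0) (x : S) :
    geomCyclotomeH1Res r q (I x) c = 0 :=
  geomCyclotomeH1Res_eq_zero_of_le r q (hI x) c hc

/-- **Reduction of the FACT-LIST row F-0042 to its converse half**: when `I_x ≤ Δ_{U_S}` for all `x`,
`Prop_2_1_ii_ker r q I` is EQUIVALENT to "a class vanishing on every `I_x` vanishes on `Δ_{U_S}`"
(exactness at `H¹(Π_{U_S}, M_X)`; the arithmetic content of Prop. 2.1 (ii)).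
[cite: MochizukiAbsCusp2007, Prop 2.1 (ii) p.36] -/
theorem prop_2_1_ii_ker_iff_forall_imp {S : Type u} (I : S → Subgroup E'.arith)
    (hI : ∀ x, I x ≤ E'.geom) :
    Literature.AnabelianGeometry.AbsoluteAnabelian.AbsCusp.Prop_2_1_ii_ker r q I ↔
      ∀ c : geomCyclotomeH1 r q,
        (∀ x : S, geomCyclotomeH1Res r q (I x) c = 0) → geomCyclotomeH1Res r q E'.geom c = 0 := by
  refine ⟨fun h c hc => (h c).mp hc, fun h c => ⟨h c, fun hc x => ?_⟩⟩
  exact prop_2_1_ii_ker_mpr r q I hI c hc x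

/-- A degenerate INSTANCE FORM of the schema, for the record: if some member of the family IS `Δ_{U_S}`
(and all lie in it), `Prop_2_1_ii_ker` holds — the converse half is then tautological.  (Shows the
schema is satisfiable as typed; carries none of the arithmetic content.)
[cite: MochizukiAbsCusp2007, Prop 2.1 (ii) p.36] -/
theorem prop_2_1_ii_ker_of_exists_eq_geom {S : Type u} (I : S → Subgroup E'.arith)
    (hI : ∀ x, I x ≤ E'.geom) (h : ∃ x₀, I x₀ = E'.geom) :
    Literature.AnabelianGeometry.AbsoluteAnabelian.AbsCusp.Prop_2_1_ii_ker r q I := by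
  obtain ⟨x₀, hx₀⟩ := h
  rw [prop_2_1_ii_ker_iff_forall_imp r q I hI]
  intro c hc
  rw [← hx₀]
  exact hc x₀

/-! ### The (M)-forms -/

/-- **[AbsCusp] Prop. 2.1 (ii), direction "(⇐)", relative to every `CurveModel`**: for every
presentation `U_S ⊆ U_x ⊆ X` of `M`, a class of `H¹(Π_{U_S}, M_X)` vanishing on `Δ_{U_S}` vanishes on the
inertia group of every cusp of `U_S` (cuspidal inertia lies in `Δ`).  No hypothesis of the (M)-form
(scheme-likeness, cyclotome presentation, MLF base, rationality of the cusps) is needed for this half.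
[cite: MochizukiAbsCusp2007, Prop 2.1 (ii) p.36] -/
theorem prop_2_1_ii_model_mpr (M : CurveModel.{u}) (US Ux X : M.Curve) (h₁ : M.IsCofiniteOpen US Ux)
    (h₂ : M.IsCofiniteOpen Ux X) (c : geomCyclotomeH1 (M.res h₁) (M.res h₂))
    (hc : geomCyclotomeH1Res (M.res h₁) (M.res h₂) (M.ext US).geom c = 0) (y : (M.cusps US).Cusp) :
    geomCyclotomeH1Res (M.res h₁) (M.res h₂) ((M.cusps US).Icusp y) c = 0 :=
  prop_2_1_ii_ker_mpr (M.res h₁) (M.res h₂) (fun y : (M.cusps US).Cusp => (M.cusps US).Icusp y)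
    (fun y => (M.cusps US).Icusp_le_geom y) c hc y

/-- **Reduction of the FACT-LIST row F-0043 to its converse half**: `Prop_2_1_ii_model M` is EQUIVALENT
to the statement that, for every presentation of `M` satisfying the printed hypotheses, a class of
`H¹(Π_{U_S}, M_X)` vanishing on all cuspidal inertia groups of `U_S` vanishes on `Δ_{U_S}`.
[cite: MochizukiAbsCusp2007, Prop 2.1 (ii) p.36] -/
theorem prop_2_1_ii_model_iff_forall_imp (M : CurveModel.{u}) :
    Literature.AnabelianGeometry.AbsoluteAnabelian.AbsCusp.Prop_2_1_ii_model M ↔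
      ∀ (US Ux X : M.Curve) (h₁ : M.IsCofiniteOpen US Ux) (h₂ : M.IsCofiniteOpen Ux X)
        (x : (M.cusps Ux).Cusp),
        M.IsScheme US → M.IsCyclotomePresentation h₂ x → IsMLF (M.base X) →
          (∀ c : (M.cusps US).Cusp, (M.cusps US).IsRational c) →
            ∀ c : geomCyclotomeH1 (M.res h₁) (M.res h₂),
              (∀ y : (M.cusps US).Cusp, geomCyclotomeH1Res (M.res h₁) (M.res h₂) ((M.cusps US).Icusp y) c = 0) →
                geomCyclotomeH1Res (M.res h₁) (M.res h₂) (M.ext US).geom c = 0 := by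
  refine forall_congr' fun US => forall_congr' fun Ux => forall_congr' fun X => ?_
  refine forall_congr' fun h₁ => forall_congr' fun h₂ => forall_congr' fun x => ?_
  refine forall_congr' fun _ => forall_congr' fun _ => forall_congr' fun _ => forall_congr' fun _ => ?_
  exact prop_2_1_ii_ker_iff_forall_imp (M.res h₁) (M.res h₂) _ fun y => (M.cusps US).Icusp_le_geom y

end AbsCusp

end Literature.AnabelianGeometry.AbsoluteAnabelian

end
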